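import Mathlib
import Summits.KontsevichZagierPeriods.KontsevichZagierPeriods.Theorems.SoloInformedSidePieces
import Summits.KontsevichZagierPeriods.KontsevichZagierPeriods.Theorems.SoloInformedRpowIntervalBounds
import Literature.NumberTheory.Transcendental.SemialgebraicRpow
import HarnessLib

/-!
# Solo-informed (A390-ii): the case analysis over one side of a prepared band

File F4f of the KERNEL LEMMA I programme.  Over a side piece `P₀` of the base of a prepared band
(the centre `θ` lies below, resp. above, every fibre) the normalised fibre is `(α(w), β(w))` with
`α ≥ 0` `ℚ`-semialgebraic and `β = ⊤` or `β = b(w)` `ℚ`-semialgebraic, and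
`I(w) = ∫_{(α, β)} s^r ds`.  Given the bundle `SoloInformedSideHyp` and the inductive hypothesis
`SoloInformedLogRoomAt k m`, the weighted fibre integral has finite integral over `P₀`:

* `soloInformed_side_top_lt_top` (`β = ⊤`): null unless `r < -1`, where `{α > 0}` is a surrogate
  piece with `S = α^r · α` and `{α = 0}` is null;
* `soloInformed_side_fin_lt_top` (`β = b`): the pieces NEAR `{0 < α, b ≤ 2α}` (`S = α^r (b − α)`),
  FAR `{2α < b}` (`S = b^r b` for `r > -1`; `S = α^r α`, resp. the logarithmic piece with
  `q = b/α`, on `{α > 0}` and a null piece on `{α = 0}` for `r < -1`, resp. `r = -1`), and the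
  empty-fibre set `{b ≤ α}` where the weighted fibre integral vanishes.
-/

open MeasureTheory Set Real
open scoped ENNReal
open Literature.ModelTheory.ExponentialFields Literature.NumberTheory.Transcendental

namespace Summit.KontsevichZagierPeriods.KontsevichZagierPeriods.Theorems

variable {k m : ℕ} {P : Set (Fin (k + m) → ℝ)} {ι : Type} [Fintype ι] {p : ℕ}
  {σ : ι → (Fin (k + m) → ℝ) → ℝ} {a α b : (Fin (k + m) → ℝ) → ℝ}
  {HW H₀ I : (Fin (k + m) → ℝ) → ℝ≥0∞} {Λ : (Fin (k + m) → ℝ) → ℝ} {CW C₂ c : ℝ}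

/-! ### Individual pieces -/

/-- NEAR piece `{0 < α < b ≤ 2α}`: surrogate `S = α^r (b − α)`. -/
theorem soloInformed_near_lt_top (ih : SoloInformedLogRoomAt k m)
    (h : SoloInformedSideHyp P p σ a HW H₀ I Λ CW C₂ c) (hα : IsSemialgebraicFunOn ℚ P α)
    (hb : IsSemialgebraicFunOn ℚ P b) (r : ℚ)
    (hP : ∀ w ∈ P, 0 < α w ∧ α w < b w ∧ b w ≤ 2 * α w ∧
      I w = ∫⁻ s in soloInformedEIoo (α w : EReal) (b w : EReal), ENNReal.ofReal (s ^ (r : ℝ)))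
    (t : Fin k → ℝ) (hfin : ∫⁻ x, H₀ (Fin.append t x) < ∞) :
    ∫⁻ x, P.indicator HW (Fin.append t x) < ∞ := by
  have hS : IsSemialgebraicFunOn ℚ P (fun w => α w ^ ((r : ℚ) : ℝ) * (b w - α w)) :=
    (IsSemialgebraicFunOn.mul_holds (hα.rpow_ratCast h.sa_P (fun w hw => (hP w hw).1) r)
      (IsSemialgebraicFunOn.sub_holds hb hα)).congr fun _ _ => rfl
  refine soloInformed_piece_surrogate ih h hS (fun w hw => ?_) (T := (2 : ℝ) ^ |(r : ℝ)|)
    (L := (2 : ℝ) ^ (-|(r : ℝ)|)) (by positivity) (by positivity) (fun w hw => ?_)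
    (fun w hw => ?_) t hfin
  · obtain ⟨h0, h1, -, -⟩ := hP w hw
    exact mul_nonneg (rpow_nonneg h0.le _) (by linarith)
  · obtain ⟨h0, -, h2, hI⟩ := hP w hw
    rw [hI, show (2 : ℝ) ^ |(r : ℝ)| * (α w ^ ((r : ℚ) : ℝ) * (b w - α w)) =
      (2 : ℝ) ^ |(r : ℝ)| * α w ^ ((r : ℚ) : ℝ) * (b w - α w) by ring]
    exact (soloInformed_Irp_near_bounds (r : ℝ) h0 h2).2
  · obtain ⟨h0, -, h2, hI⟩ := hP w hw
    rw [hI, show (2 : ℝ) ^ (-|(r : ℝ)|) * (α w ^ ((r : ℚ) : ℝ) * (b w - α w)) =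
      (2 : ℝ) ^ (-|(r : ℝ)|) * α w ^ ((r : ℚ) : ℝ) * (b w - α w) by ring]
    exact (soloInformed_Irp_near_bounds (r : ℝ) h0 h2).1

/-- FAR piece `{0 ≤ α, 2α < b}` for `r > -1`: surrogate `S = b^r b`. -/
theorem soloInformed_far_pos_lt_top (ih : SoloInformedLogRoomAt k m)
    (h : SoloInformedSideHyp P p σ a HW H₀ I Λ CW C₂ c) (hb : IsSemialgebraicFunOn ℚ P b)
    {r : ℚ} (hr : (-1 : ℝ) < r)
    (hP : ∀ w ∈ P, 0 ≤ α w ∧ 2 * α w < b w ∧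
      I w = ∫⁻ s in soloInformedEIoo (α w : EReal) (b w : EReal), ENNReal.ofReal (s ^ (r : ℝ)))
    (t : Fin k → ℝ) (hfin : ∫⁻ x, H₀ (Fin.append t x) < ∞) :
    ∫⁻ x, P.indicator HW (Fin.append t x) < ∞ := by
  have hbpos : ∀ w ∈ P, 0 < b w := fun w hw => by
    obtain ⟨h0, h2, -⟩ := hP w hw
    linarith
  have hS : IsSemialgebraicFunOn ℚ P (fun w => b w ^ ((r : ℚ) : ℝ) * b w) :=
    (IsSemialgebraicFunOn.mul_holds (hb.rpow_ratCast h.sa_P hbpos r) hb).congr fun _ _ => rfl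
  have hr1 : (0 : ℝ) < r + 1 := by linarith
  refine soloInformed_piece_surrogate ih h hS
    (fun w hw => mul_nonneg (rpow_nonneg (hbpos w hw).le _) (hbpos w hw).le)
    (T := 1 / ((r : ℝ) + 1)) (L := (2 : ℝ) ^ (-|(r : ℝ)|) * ((2 : ℝ) ^ (-(r : ℝ)) / 2))
    (by positivity) (by positivity) (fun w hw => ?_) (fun w hw => ?_) t hfin
  · obtain ⟨h0, h2, hI⟩ := hP w hw
    rw [hI, show 1 / ((r : ℝ) + 1) * (b w ^ ((r : ℚ) : ℝ) * b w) =
      b w ^ ((r : ℚ) : ℝ) * b w / ((r : ℝ) + 1) by ring]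
    exact soloInformed_Irp_pos_upper hr h0 (hbpos w hw)
  · obtain ⟨h0, h2, hI⟩ := hP w hw
    rw [hI]
    exact soloInformed_Irp_pos_lower (r : ℝ) h2.le (hbpos w hw)

/-- FAR piece `{0 < α, 2α < β}` (`β = b` or `β = ⊤`) for `r < -1`: surrogate `S = α^r α`. -/
theorem soloInformed_far_neg_lt_top (ih : SoloInformedLogRoomAt k m)
    (h : SoloInformedSideHyp P p σ a HW H₀ I Λ CW C₂ c) (hα : IsSemialgebraicFunOn ℚ P α)
    {r : ℚ} (hr : (r : ℝ) < -1) (β : (Fin (k + m) → ℝ) → EReal)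
    (hP : ∀ w ∈ P, 0 < α w ∧ ((2 * α w : ℝ) : EReal) ≤ β w ∧
      I w = ∫⁻ s in soloInformedEIoo (α w : EReal) (β w), ENNReal.ofReal (s ^ (r : ℝ)))
    (t : Fin k → ℝ) (hfin : ∫⁻ x, H₀ (Fin.append t x) < ∞) :
    ∫⁻ x, P.indicator HW (Fin.append t x) < ∞ := by
  have hS : IsSemialgebraicFunOn ℚ P (fun w => α w ^ ((r : ℚ) : ℝ) * α w) :=
    (IsSemialgebraicFunOn.mul_holds (hα.rpow_ratCast h.sa_P (fun w hw => (hP w hw).1) r)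
      hα).congr fun _ _ => rfl
  have hr1 : (0 : ℝ) < -((r : ℝ) + 1) := by linarith
  refine soloInformed_piece_surrogate ih h hS
    (fun w hw => mul_nonneg (rpow_nonneg (hP w hw).1.le _) (hP w hw).1.le)
    (T := 1 / -((r : ℝ) + 1)) (L := (2 : ℝ) ^ (r : ℝ)) (by positivity) (by positivity)
    (fun w hw => ?_) (fun w hw => ?_) t hfin
  · obtain ⟨h0, -, hI⟩ := hP w hw
    rw [hI, show 1 / -((r : ℝ) + 1) * (α w ^ ((r : ℚ) : ℝ) * α w) =
      α w ^ ((r : ℚ) : ℝ) * α w / -((r : ℝ) + 1) by ring]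
    exact soloInformed_Irp_neg_upper hr h0 (β w)
  · obtain ⟨h0, h2, hI⟩ := hP w hw
    rw [hI]
    exact soloInformed_Irp_neg_lower hr h0 h2

/-- FAR piece `{0 < α, 2α < b}` for `r = -1`: logarithmic piece with `q = b / α`. -/
theorem soloInformed_far_inv_lt_top (ih : SoloInformedLogRoomAt k m)
    (h : SoloInformedSideHyp P p σ a HW H₀ I Λ CW C₂ c) (hα : IsSemialgebraicFunOn ℚ P α)
    (hb : IsSemialgebraicFunOn ℚ P b) {r : ℚ} (hr : (r : ℝ) = -1)
    (hP : ∀ w ∈ P, 0 < α w ∧ 2 * α w < b w ∧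
      I w = ∫⁻ s in soloInformedEIoo (α w : EReal) (b w : EReal), ENNReal.ofReal (s ^ (r : ℝ)))
    (t : Fin k → ℝ) (hfin : ∫⁻ x, H₀ (Fin.append t x) < ∞) :
    ∫⁻ x, P.indicator HW (Fin.append t x) < ∞ := by
  have hq : IsSemialgebraicFunOn ℚ P (fun w => b w / α w) :=
    hb.div hα fun w hw => (hP w hw).1.ne'
  refine soloInformed_piece_log ih h hq (fun w hw => ?_) (fun w hw => ?_) (fun w hw => ?_) t hfin
  · obtain ⟨h0, h2, -⟩ := hP w hw
    rw [one_le_div h0]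
    linarith
  · obtain ⟨h0, h2, hI⟩ := hP w hw
    rw [hI, hr]
    exact soloInformed_Irp_inv_upper h0 (by linarith)
  · obtain ⟨h0, h2, hI⟩ := hP w hw
    rw [hI, hr]
    exact soloInformed_Irp_inv_lower h0 (EReal.coe_le_coe_iff.mpr h2.le)

/-- Null piece `{α = 0 < β}` for `r ≤ -1`. -/
theorem soloInformed_far_zero_lt_top (h : SoloInformedSideHyp P p σ a HW H₀ I Λ CW C₂ c)
    {r : ℚ} (hr : (r : ℝ) ≤ -1) (β : (Fin (k + m) → ℝ) → EReal)
    (hP : ∀ w ∈ P, α w = 0 ∧ (0 : EReal) < β w ∧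
      I w = ∫⁻ s in soloInformedEIoo (α w : EReal) (β w), ENNReal.ofReal (s ^ (r : ℝ)))
    (t : Fin k → ℝ) (hfin : ∫⁻ x, H₀ (Fin.append t x) < ∞) :
    ∫⁻ x, P.indicator HW (Fin.append t x) < ∞ := by
  refine soloInformed_piece_null h (fun w hw => ?_) t hfin
  obtain ⟨h0, hβ, hI⟩ := hP w hw
  rw [hI, h0]
  exact soloInformed_Irp_zero_eq_top hr hβ

/-! ### The two sides -/

/-- Measurability of a Boolean pair of semialgebraic pieces. -/
theorem soloInformed_measurableSet_cond {n : ℕ} {P₁ P₂ : Set (Fin n → ℝ)}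
    (h₁ : IsSemialgebraic ℚ P₁) (h₂ : IsSemialgebraic ℚ P₂) (bb : Bool) :
    MeasurableSet (cond bb P₁ P₂) := by
  cases bb
  · exact h₂.measurableSet_holds
  · exact h₁.measurableSet_holds

/-- **Side with infinite fibres** (`β = ⊤`): finiteness of the weighted integral over `P₀`. -/
theorem soloInformed_side_top_lt_top (ih : SoloInformedLogRoomAt k m)
    (h : SoloInformedSideHyp P p σ a HW H₀ I Λ CW C₂ c) (hα : IsSemialgebraicFunOn ℚ P α)
    (r : ℚ)
    (hP : ∀ w ∈ P, 0 ≤ α w ∧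
      I w = ∫⁻ s in soloInformedEIoo (α w : EReal) ⊤, ENNReal.ofReal (s ^ (r : ℝ)))
    (t : Fin k → ℝ) (hfin : ∫⁻ x, H₀ (Fin.append t x) < ∞) :
    ∫⁻ x, P.indicator HW (Fin.append t x) < ∞ := by
  rcases lt_or_ge (r : ℝ) (-1) with hr | hr
  swap
  · refine soloInformed_piece_null h (fun w hw => ?_) t hfin
    obtain ⟨h0, hI⟩ := hP w hw
    rw [hI]
    exact soloInformed_Irp_top_eq_top_of_le hr h0
  · have hfar : IsSemialgebraic ℚ {w | w ∈ P ∧ (-α) w < 0} := hα.neg.isSemialgebraic_sep_neg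
    have hnull : IsSemialgebraic ℚ {w | w ∈ P ∧ 0 ≤ (-α) w} := hα.neg.isSemialgebraic_sep_nonneg
    refine soloInformed_cover_lintegral_lt_top' (B := P)
      (fun bb : Bool => cond bb {w | w ∈ P ∧ (-α) w < 0} {w | w ∈ P ∧ 0 ≤ (-α) w})
      (soloInformed_measurableSet_cond hfar hnull) h.meas_HW (fun w hw => Or.inr ?_) t ?_
    · rcases lt_or_ge ((-α) w) 0 with hlt | hge
      · exact ⟨true, hw, hlt⟩
      · exact ⟨false, hw, hge⟩
    · rintro (_ | _)
      · refine soloInformed_far_zero_lt_top (α := α) (h.mono (fun w hw => hw.1) hnull) hr.le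
          (fun _ => ⊤) (fun w hw => ?_) t hfin
        obtain ⟨h0, hI⟩ := hP w hw.1
        have h1 : 0 ≤ -α w := hw.2
        exact ⟨by linarith, EReal.zero_lt_top, hI⟩
      · refine soloInformed_far_neg_lt_top ih (h.mono (fun w hw => hw.1) hfar)
          (hα.mono (fun w hw => hw.1) hfar) hr (fun _ => ⊤) (fun w hw => ?_) t hfin
        obtain ⟨-, hI⟩ := hP w hw.1
        have h1 : -α w < 0 := hw.2
        exact ⟨by linarith, le_top, hI⟩

/-- **Side with bounded fibres** (`β = b`): finiteness of the weighted integral over `P₀`. -/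
theorem soloInformed_side_fin_lt_top (ih : SoloInformedLogRoomAt k m)
    (h : SoloInformedSideHyp P p σ a HW H₀ I Λ CW C₂ c) (hα : IsSemialgebraicFunOn ℚ P α)
    (hb : IsSemialgebraicFunOn ℚ P b) (r : ℚ)
    (hP : ∀ w ∈ P, 0 ≤ α w ∧
      (α w < b w → I w = ∫⁻ s in soloInformedEIoo (α w : EReal) (b w : EReal),
        ENNReal.ofReal (s ^ (r : ℝ))) ∧ (b w ≤ α w → HW w = 0))
    (t : Fin k → ℝ) (hfin : ∫⁻ x, H₀ (Fin.append t x) < ∞) :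
    ∫⁻ x, P.indicator HW (Fin.append t x) < ∞ := by
  -- the pieces NEAR and FAR
  have hnear : IsSemialgebraic ℚ ({w | w ∈ P ∧ (-α) w < 0} ∩ ({w | w ∈ P ∧ (α - b) w < 0} ∩
      {w | w ∈ P ∧ 0 ≤ (α + α - b) w})) :=
    hα.neg.isSemialgebraic_sep_neg.inter
      ((IsSemialgebraicFunOn.sub_holds hα hb).isSemialgebraic_sep_neg.inter
        (IsSemialgebraicFunOn.sub_holds (IsSemialgebraicFunOn.add_holds hα hα)
          hb).isSemialgebraic_sep_nonneg)
  have hfar : IsSemialgebraic ℚ {w | w ∈ P ∧ (α + α - b) w < 0} :=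
    (IsSemialgebraicFunOn.sub_holds (IsSemialgebraicFunOn.add_holds hα hα) hb).isSemialgebraic_sep_neg
  refine soloInformed_cover_lintegral_lt_top' (B := P)
    (fun bb : Bool => cond bb ({w | w ∈ P ∧ (-α) w < 0} ∩ ({w | w ∈ P ∧ (α - b) w < 0} ∩
      {w | w ∈ P ∧ 0 ≤ (α + α - b) w})) {w | w ∈ P ∧ (α + α - b) w < 0})
    (soloInformed_measurableSet_cond hnear hfar) h.meas_HW (fun w hw => ?_) t ?_
  · -- cover
    obtain ⟨h0, -, hI2⟩ := hP w hw
    by_cases hba : b w ≤ α w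
    · exact Or.inl (hI2 hba)
    · rw [not_le] at hba
      refine Or.inr ?_
      rcases lt_or_ge (α w + α w - b w) 0 with hlt | hge
      · exact ⟨false, hw, by simpa only [Pi.sub_apply, Pi.add_apply] using hlt⟩
      · have hαpos : 0 < α w := by
          rcases h0.lt_or_eq with h | h
          · exact h
          · exfalso; rw [← h] at hge hba; linarith
        refine ⟨true, ⟨hw, ?_⟩, ⟨hw, ?_⟩, ⟨hw, ?_⟩⟩
        · show -α w < 0
          linarith
        · show α w - b w < 0
          linarith
        · simpa only [Pi.sub_apply, Pi.add_apply] using hge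
  · rintro (_ | _)
    · -- FAR
      have hF : ∀ w ∈ {w | w ∈ P ∧ (α + α - b) w < 0}, 0 ≤ α w ∧ 2 * α w < b w ∧
          I w = ∫⁻ s in soloInformedEIoo (α w : EReal) (b w : EReal),
            ENNReal.ofReal (s ^ (r : ℝ)) := fun w hw => by
        obtain ⟨h0, hI1, -⟩ := hP w hw.1
        have h2 : α w + α w - b w < 0 := by simpa only [Pi.sub_apply, Pi.add_apply] using hw.2
        exact ⟨h0, by linarith, hI1 (by linarith)⟩
      have h' := h.mono (fun w hw => hw.1) hfar
      have hα' := hα.mono (fun w hw => hw.1) hfar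
      have hb' := hb.mono (fun w hw => hw.1) hfar
      rcases lt_or_ge (-1 : ℝ) r with hr | hr
      · exact soloInformed_far_pos_lt_top ih h' hb' hr hF t hfin
      · -- `r ≤ -1`: split by the sign of `α`
        set F := {w | w ∈ P ∧ (α + α - b) w < 0} with hFdef
        have hFp : IsSemialgebraic ℚ {w | w ∈ F ∧ (-α) w < 0} := hα'.neg.isSemialgebraic_sep_neg
        have hFz : IsSemialgebraic ℚ {w | w ∈ F ∧ 0 ≤ (-α) w} :=
          hα'.neg.isSemialgebraic_sep_nonneg
        refine soloInformed_cover_lintegral_lt_top' (B := F)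
          (fun bb : Bool => cond bb {w | w ∈ F ∧ (-α) w < 0} {w | w ∈ F ∧ 0 ≤ (-α) w})
          (soloInformed_measurableSet_cond hFp hFz) h.meas_HW (fun w hw => Or.inr ?_) t ?_
        · rcases lt_or_ge ((-α) w) 0 with hlt | hge
          · exact ⟨true, hw, hlt⟩
          · exact ⟨false, hw, hge⟩
        · rintro (_ | _)
          · refine soloInformed_far_zero_lt_top (α := α) (h'.mono (fun w hw => hw.1) hFz) hr
              (fun w => (b w : EReal)) (fun w hw => ?_) t hfin
            obtain ⟨h0, h2, hI⟩ := hF w hw.1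
            have h1 : 0 ≤ -α w := hw.2
            have hα0 : α w = 0 := by linarith
            exact ⟨hα0, by rw [hα0] at h2; exact_mod_cast (by linarith : 0 < b w), hI⟩
          · have hpos : ∀ w ∈ {w | w ∈ F ∧ (-α) w < 0}, 0 < α w := fun w hw => by
              have h1 : -α w < 0 := hw.2
              linarith
            rcases hr.lt_or_eq with hr' | hr'
            · refine soloInformed_far_neg_lt_top ih (h'.mono (fun w hw => hw.1) hFp)
                (hα'.mono (fun w hw => hw.1) hFp) hr' (fun w => (b w : EReal)) (fun w hw => ?_)
                t hfin
              obtain ⟨-, h2, hI⟩ := hF w hw.1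
              exact ⟨hpos w hw, EReal.coe_le_coe_iff.mpr h2.le, hI⟩
            · exact soloInformed_far_inv_lt_top ih (h'.mono (fun w hw => hw.1) hFp)
                (hα'.mono (fun w hw => hw.1) hFp) (hb'.mono (fun w hw => hw.1) hFp) hr'
                (fun w hw => by
                  obtain ⟨-, h2, hI⟩ := hF w hw.1
                  exact ⟨hpos w hw, h2, hI⟩) t hfin
    · -- NEAR
      refine soloInformed_near_lt_top ih (h.mono (fun w hw => hw.1.1) hnear)
        (hα.mono (fun w hw => hw.1.1) hnear) (hb.mono (fun w hw => hw.1.1) hnear) r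
        (fun w hw => ?_) t hfin
      obtain ⟨⟨hwP, h1⟩, ⟨-, h2⟩, ⟨-, h3⟩⟩ := hw
      have h1' : -α w < 0 := h1
      have h2' : α w - b w < 0 := h2
      have h3' : 0 ≤ α w + α w - b w := by simpa only [Pi.sub_apply, Pi.add_apply] using h3
      obtain ⟨-, hI1, -⟩ := hP w hwP
      exact ⟨by linarith, by linarith, by linarith, hI1 (by linarith)⟩

end Summit.KontsevichZagierPeriods.KontsevichZagierPeriods.Theorems
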